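import Literature.MathematicalPhysics.QuantumFieldTheory.Balaban1983to89.Node00.CarriersZ
import Literature.MathematicalPhysics.QuantumFieldTheory.Balaban1983to89.BlockAveragingSectionPlaq

/-!
# BalabanUVNodes ∕ N07 ([B11]) — SECTION A OF [Balaban1985Variational] AT NODE 00's OBJECTS, TOWER-FREE: the printed background datum `V₀` of (11)
# IS the tree's face section `BlockAveragingSection.faceSec`, and on the torus of record (no holes, `Ω_j = T`) the three Sect.-A sentences —
# (11) «V₀ satisfies (7) … V̄₀ = V», (12) ⇒ (13) «the form (2)» with `C₁ = L³`, and «for k = 1 … we take simply U₀ = V₀» with (14) — are THEOREMS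
# about n07-a's carrier `B11Thm1CarrierT.varProblemT` (CarriersZ :90, `rfl`); hence the inductive background of (12)–(14) from Theorem 1 one level down

Track A of `YM-PLAN.md` (cell `pub-ymgap`, HUMAN RULING D-0062), node **N07** = [Balaban1985Variational] Thm 1 p. 279 + Props 2–9 pp. 281–309; seat
`pub-ymgap-dag-n07-e` (generation 0; director-ym R141 (C) WIDER STRATEGY FAN-OUT, `FAN-OUT.md` v1.1 §N07 row s3 «REPAIRED-TOWER CURRENCY … with the
repair displayed as the located caveat (G-B11 rows)»; companion of seat `-d`'s record-level two-tier module, which builds `B11Thm1TwoTier.TowerT` at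
`Node00.famXOfRecord` and composes `thm1TAt_allLevels` — this file supplies, BY NAME and tower-free, the OBJECT-LEVEL content of that tower's Sect.-A
leaves `StepA11T ∕ StepA13T ∕ BaseK1T` and of the printed tower's `B11Thm1.StepA11 ∕ StepA13 ∕ BaseK1` at `κ₀ = 1`).  THEOREMS ONLY (0 `def`, 0 `sorry`,
standard axioms); COUNT-NEUTRAL; `--supports stmt-QuantumFields-19674` (K1 `StabilityBAtRecordR11e`).

T. Bałaban, *The variational problem and background fields in renormalization group method for lattice gauge theories*, Commun. Math. Phys. **102**
(1985) 277–309 [Balaban1985Variational], Sect. A pp. 279–280 (PDF held `paper:balaban1985-cmp102-variational-background`, journal page = pdf + 276),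
verbatim: *«We can easily construct a configuration V₀ on 𝔅′_{k−1} such that it satisfies (7) on 𝔅′_{k−1}, and V₀ = V on ⋃_{j=0}^{k−1} Λ_j, V̄₀ = V on
Λ_k. (11) For example we can take V_{0,b} = V_{b′}, for b ∈ B(b′), b′ ∈ Λ_k and V_{0,b} = 1 for remaining bonds of B(Λ_k). … We get a minimal
configuration U₀ = U_{k−1}(V₀) belonging to the space 𝔘_{k−1}({Ω_j}, B₃ε₁) ∩ 𝔅_{k−1}(𝔅′_{k−1}, V₀). (12) From the conditions (11), and from the form (2)
of the regularity conditions, it follows that U₀ ∈ 𝔘_k({Ω_j}, B₃L³ε₁) ∩ 𝔅_k(𝔅_k, V), (13) … The configuration U₀ constructed above satisfies (14) with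
C₁ = L³. Let us notice that for k = 1 we do not have any solutions of the variational problem yet, and then we take simply U₀ = V₀.»*

THE LOCATED CAVEAT AND WHY IT DOES NOT BITE HERE.  Cell GAPS G-B11-A1b (`B11V0Interface`, `pub-balaban` V0-REPAIR.md §4): in the MULTI-DOMAIN case
`Λ_{k−1} ≠ ∅` the printed assignment of (11) violates (7) on interface plaquettes, whence the repaired two-tier tower `B11Thm1TwoTier` (κ₀ = 1 + 6(d−1)L(L−1)).
NODE 00's objects are the NO-HOLES tori `Ω_0 = … = Ω_k = T` (`B11Thm1CarrierT`, `Node00.ZIdx`): there `Λ_{k−1} = ∅`, `B(Λ_k)` is the whole next-finer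
torus, the printed V₀ is EXACTLY the face section `faceSec V` of the (0.4) block averaging (the coarse bond variable on the fine bonds EXITING their block,
`1` on all others — cell `ym3-torus`, `BlockAveragingSection` p411383), and the two halves of (11) are tree theorems for every `Params`, every gauge group:
`BlockAveragingSectionPlaq.plaqSmall_faceSec` ((7) at the SAME `ε₁`: every fine plaquette variable is `1` or a coarse one, `plaqHol_faceSec`) and
`BlockAveragingSection.blockAvg_faceSec` (`V̄₀ = V` EXACTLY, for every small-loop average with `ℰ(1,…,1) = 1` — the printed exp[mean log], §1).  So at the
record the repair's constant is `κ₀ = 1` and print's Sect. A stands as printed; the repaired tower remains the currency for multi-domain consumers ([B16]).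

CONTENT (all at the `K`-th approximation of a four-torus family `F`, group `SU(N)`, averaging of record `Node00.avOfRecord F N K k = blockAvg expMeanLogSU`):
* §1 `expMeanLogSU_E_const_one` (the printed small-loop average of the constant family `1` is `1`; node-namespaced twin of the T³ ladder's
  `T3DescentFibreTower.expMeanLogSU_E_one`, re-proved so that NODE 00's import DAG stays off that ladder), **`avOfRecord_avg_faceSec`** ((11b) «V̄₀ = V»:
  `(avOfRecord F N K k).avg (faceSec V) = V`, `k + 1 ≤ K`), `iter_succ_of_iter_eq_faceSec` (`Ū^k = V₀ ⇒ Ū^{k+1} = V`), `plaqSmall_faceSec_record` ((11a)).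
* §2 Sect. A in the carrier's own fields (`varProblemT F N K k R`: `.Reg7 = PlaqSmall`, `.InU = Node00.InUkClassB11`, `.InB V U = (Ū^k = V)`, all `Iff.rfl`):
  **`reg7_faceSec`** ((11) ⇒ (7) one level down, SAME `ε₁` — `B11Thm1.StepA11`'s sentence at objects), **`inUkClassB11_levelSucc`** ∕ `inU_levelSucc` ((13) «the
  form (2)»: `𝔘_k(e) ⊆ 𝔘_{k+1}(L³e)` on the torus of record — plaquette thresholds gain `L² ≤ L³`, the divergence clause is `η`-free
  (`B10Eq68TorusRegularity.regDivAt_iff_unit`) and gains exactly `L³`; `B11Thm1.ineq13_plaquette_factor ∕ ineq13_bond_factor` at objects),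
  `inB_succ_of_inB_faceSec` ((3) one level up, EXACT), **`stepA13_objects`** ((12) ⇒ (13): `B11Thm1.StepA13`'s printed shape with the exact 𝔅_k(V), which is
  STRONGER than the repaired `StepA13T`'s «|Ū₀ − V| < C′₁ε₁»), **`sat14_faceSec_levelOne`** («k = 1: U₀ = V₀» with (13)∕(14), `C₁ = L³`, for `B₃ ≥ 7`:
  n07-a's `B11Thm1LevelZero.inUkClassB11_zero_of_plaqSmall` one level up — `B11Thm1.BaseK1` at objects, GAPS G-B11-A2 a theorem there).
* §3 **`exists_background13_of_thm1At`**: THE INDUCTIVE BACKGROUND (12)–(13) AT OBJECTS — Theorem 1 at given constants for the level-`k` member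
  (`B11Thm1.Thm1At C (varProblemT F N K k R₀)`) and a level-`(k+1)` datum `V` with (7) at `0 < ε₁ ≤ a₁` give `U₀ ∈ 𝔘_{k+1}(L³B₃ε₁)` with `Ū₀^{k+1} = V`, namely the
  level-`k` minimal configuration over the datum `V₀ = faceSec V`; `sat14_of_thm1At` (the same as (14) with `C₁ = L³`, the exact boundary condition implying
  every `Near`-type reading); `exists_background14_upTo_of_thm1At` (all levels `≤ k₀ + 1` from Theorem 1 at the levels `≤ k₀`; level `0` by `V` itself, `7 ≤ L³B₃`).

HONEST FRAMING.  Elementary lattice bookkeeping (the one estimate with content, the scale-0 divergence bound behind `B₃ ≥ 7`, is n07-a's); NOTHING of Sects. B–G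
is touched: [B11] Theorem 1 for `k ≥ 1` is proved nowhere in the tree and is NOT proved here (its inputs at the record remain Props 2, 5, 6, 8, Sect. F — seat
-d's and n07-a's displayed slots); N07 NOT discharged; counts 5∕27 unmoved; no object of record is modified; one finite four-torus programme at fixed `ε` —
NOT continuum ∕ ℝ⁴ ∕ infinite volume ∕ OS ∕ mass gap ∕ Clay.  No `def`, no `instance`, no `notation`.
-/

noncomputable section

namespace Summit.QuantumFields.YangMills.BalabanUVNodes.N07SectAObjects

open Literature.MathematicalPhysics.QuantumFieldTheory.Balaban1983to89
open Literature.MathematicalPhysics.QuantumFieldTheory.Balaban1983to89.T4Continuum (T4Family)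
open Literature.MathematicalPhysics.QuantumFieldTheory.Balaban1983to89.Node00
open Literature.MathematicalPhysics.QuantumFieldTheory.Balaban1983to89.BlockAveraging (blockAvg blockAvg_avg)
open Literature.MathematicalPhysics.QuantumFieldTheory.Balaban1983to89.BlockAveragingSection (faceSec blockAvg_faceSec)
open Literature.MathematicalPhysics.QuantumFieldTheory.Balaban1983to89.BlockAveragingSectionPlaq (plaqSmall_faceSec)
open Literature.MathematicalPhysics.QuantumFieldTheory.Balaban1983to89.B11Thm1 (Thm1At Exists8)
open Literature.MathematicalPhysics.QuantumFieldTheory.Balaban1983to89.B11Thm1CarrierT (RegCarrierT varProblemT)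
open Literature.MathematicalPhysics.QuantumFieldTheory.Balaban1983to89.B10Eq68TorusRegularity (RegDivAt RegPlaqAt InSpaceA InSpace regDivAt_iff_unit)
open scoped Matrix.Norms.L2Operator

variable {F : T4Family} {N : ℕ} [NeZero N]

/-! ## §1 The printed `V₀` of (11) is the face section of the averaging of record; `V̄₀ = V` exactly; (7) is kept -/

omit [NeZero N] in
/-- **The printed small-loop average of a constant family `1` is `1`** (`exp[mean log 1] = exp 0`; the side condition of `blockAvg_faceSec` for Bałaban's
exp[mean log], [Balaban1987RG1] (0.4) — the T³ ladder's `T3DescentFibreTower.expMeanLogSU_E_one`, re-proved here under the node's namespace so that NODE 00's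
import graph does not acquire the `d = 3` tower). [cite: Balaban1987RG1, (0.4) p.253] -/
theorem expMeanLogSU_E_const_one [Nonempty (Fin N)] (n : ℕ) :
    (ExpMeanLog.expMeanLogSU (n := Fin N)).E (fun _ : Fin (n + 1) => (1 : SU N)) = 1 := by
  show ExpMeanLog.ESU (fun _ : Fin (n + 1) => (1 : SU N)) = 1
  have h : ∀ i : Fin (n + 1), ‖(((fun _ => (1 : SU N)) i : SU N) : Matrix (Fin N) (Fin N) ℂ) - 1‖ < ExpMeanLog.deltaSU (Fin N) := fun i => by
    simp only [OneMemClass.coe_one, sub_self, norm_zero]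
    exact ExpMeanLog.deltaSU_pos
  apply Subtype.ext
  rw [ExpMeanLog.coe_ESU_of_small h, ExpMeanLog.eml_eq_exp]
  simp

/-- NODE 00's standing range at a member `(K, k+1)` of print's family index: `k + 1 ≤ K` gives `k + 1 ≤ m + K` for the `K`-th torus `F.P K` (`m ≥ 0`).
[cite: Balaban1987RG1, (0.1) p.251 (bookkeeping)] -/
private theorem range_of_succ_le {K k : ℕ} (hk : k + 1 ≤ K) : k + 1 ≤ (F.P K).m + (F.P K).K := by
  simp only [T4Family.P_m, T4Family.P_K]; omega

/-- **(11b) «V̄₀ = V on Λ_k» EXACTLY at NODE 00's averaging of record**: the (0.4) block average with the printed exp[mean log] of the face section of `V` is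
`V` (`BlockAveragingSection.blockAvg_faceSec` BY NAME at `Node00.avOfRecord F N K k = blockAvg expMeanLogSU`). [cite: Balaban1985Variational, (11) p.279; Balaban1987RG1, (0.4) p.253] -/
theorem avOfRecord_avg_faceSec {K k : ℕ} (hk : k + 1 ≤ K) (V : GaugeField (F.P K) (k + 1) (SU N)) :
    (avOfRecord F N K k).avg (faceSec V) = V := by
  haveI : Nonempty (Fin N) := ⟨⟨0, Nat.pos_of_ne_zero (NeZero.ne N)⟩⟩
  rw [avOfRecord_apply]
  exact blockAvg_faceSec (range_of_succ_le hk) _ expMeanLogSU_E_const_one V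

/-- `Ū^k = V₀ ⇒ Ū^{k+1} = V` for `V₀ = faceSec V` (`Averaging.iter` one step up + (11b)). [cite: Balaban1985Variational, (11) and (13) pp.279–280; Balaban1987RG1, (0.11) p.253] -/
theorem iter_succ_of_iter_eq_faceSec {K k : ℕ} (hk : k + 1 ≤ K) {V : GaugeField (F.P K) (k + 1) (SU N)} {U : GaugeField (F.P K) 0 (SU N)}
    (hU : Averaging.iter (avOfRecord F N K) k U = faceSec V) : Averaging.iter (avOfRecord F N K) (k + 1) U = V := by
  show (avOfRecord F N K k).avg (Averaging.iter (avOfRecord F N K) k U) = V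
  rw [hU, avOfRecord_avg_faceSec hk]

/-- **(11a) «V₀ satisfies (7)» WITH THE SAME `ε₁`** at NODE 00's objects (`BlockAveragingSectionPlaq.plaqSmall_faceSec` BY NAME: every fine plaquette variable of
`faceSec V` is `1` or a plaquette variable of `V`; the located objection G-B11-A1b concerns interface plaquettes, absent on the no-holes torus).
[cite: Balaban1985Variational, (11) p.279, (7) p.278] -/
theorem plaqSmall_faceSec_record {K k : ℕ} (hk : k + 1 ≤ K) {ε₁ : ℝ} (hε₁ : 0 < ε₁) {V : GaugeField (F.P K) (k + 1) (SU N)}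
    (hV : PlaqSmall ε₁ V) : PlaqSmall ε₁ (faceSec V) :=
  plaqSmall_faceSec (range_of_succ_le hk) hε₁ hV

/-! ## §2 Sect. A in the carrier's own fields: (11) ⇒ (7), (12) ⇒ (13) «the form (2)», (3) one level up, «k = 1: U₀ = V₀» -/

/-- **STEP (11) ⇒ (7) AT OBJECTS, SAME `ε₁`** (the sentence of the leaf `B11Thm1.StepA11`, resp. `B11Thm1TwoTier.StepA11T` at `κ₀ = 1`, for the no-holes
carrier): if the level-`(k+1)` datum `V` satisfies (7) with `ε₁ > 0` then so does the level-`k` datum `V₀ = faceSec V`. [cite: Balaban1985Variational, (11) p.279] -/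
theorem reg7_faceSec {K k : ℕ} (hk : k + 1 ≤ K) (R₀ R₁ : RegCarrierT F N K) {ε₁ : ℝ} (hε₁ : 0 < ε₁)
    {V : GaugeField (F.P K) (k + 1) (SU N)} (hV : (varProblemT F N K (k + 1) R₁).Reg7 ε₁ V) :
    (varProblemT F N K k R₀).Reg7 ε₁ (faceSec V) :=
  plaqSmall_faceSec_record hk hε₁ hV

omit [NeZero N] in
/-- **(13) «THE FORM (2)» AT NODE 00's OBJECTS: `𝔘_k({T}, e) ⊆ 𝔘_{k+1}({T}, L³e)`** (`e ≥ 0`).  On the no-holes torus every scale clause of (2) ranges over ALL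
plaquettes ∕ bonds; the clauses `j ≤ k` pass by monotonicity in the constant (`L³ ≥ 1`), and the new top clause `j = k + 1` is the old top clause `j = k`: for
plaquettes `eL^{−2k} = (L²e)L^{−2(k+1)} ≤ (L³e)L^{−2(k+1)}`, for the covariant divergence — whose threshold `εL^{−2j}(L^jη)^{−1}` is `εL^{−3j}` in spacing-free
form (`regDivAt_iff_unit`), so the change `η_k ↦ η_{k+1}` is immaterial — `eL^{−3k} = (L³e)L^{−3(k+1)}` exactly (the arithmetic of
`B11Thm1.ineq13_plaquette_factor ∕ ineq13_bond_factor`). [cite: Balaban1985Variational, (2) p.278, (13) p.280] -/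
private theorem inUkClassB11_levelSucc {K k : ℕ} {e : ℝ} (he : 0 ≤ e) {U : GaugeField (F.P K) 0 (SU N)} (h : InUkClassB11 F N K k e U) :
    InUkClassB11 F N K (k + 1) (((F.P K).L : ℝ) ^ 3 * e) U := by
  have hLpos : (0 : ℝ) < (F.P K).L := Nat.cast_pos.mpr (F.P K).L_pos
  have hL1 : (1 : ℝ) ≤ (F.P K).L := by exact_mod_cast (F.P K).hL.2.le
  have hL3 : (1 : ℝ) ≤ ((F.P K).L : ℝ) ^ 3 := one_le_pow₀ hL1
  have hη : ∀ j : ℕ, 0 < (F.P K).eta j := fun j => pow_pos (inv_pos.mpr hLpos) j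
  have hmono : e ≤ ((F.P K).L : ℝ) ^ 3 * e := le_mul_of_one_le_left he hL3
  -- the arithmetic of «the form (2)» one level up (`B11Thm1.ineq13_plaquette_factor ∕ ineq13_bond_factor`)
  have arith2 : ∀ x : ℝ, 1 ≤ x → e * ((x ^ k)⁻¹) ^ 2 ≤ x ^ 3 * e * ((x ^ (k + 1))⁻¹) ^ 2 := fun x hx => by
    have hx0 : 0 < x := lt_of_lt_of_le one_pos hx
    have hsucc : x ^ (k + 1) = x ^ k * x := pow_succ x k
    calc e * ((x ^ k)⁻¹) ^ 2 ≤ (x * e) * ((x ^ k)⁻¹) ^ 2 :=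
          mul_le_mul_of_nonneg_right (le_mul_of_one_le_left he hx) (by positivity)
      _ = x ^ 3 * e * ((x ^ (k + 1))⁻¹) ^ 2 := by rw [hsucc]; field_simp
  have arith3 : ∀ x : ℝ, 1 ≤ x → e * ((x ^ k)⁻¹) ^ 3 = x ^ 3 * e * ((x ^ (k + 1))⁻¹) ^ 3 := fun x hx => by
    have hx0 : 0 < x := lt_of_lt_of_le one_pos hx
    have hsucc : x ^ (k + 1) = x ^ k * x := pow_succ x k
    rw [hsucc]; field_simp
  -- the scale-`k` clauses of the hypothesis, the divergence one in spacing-free form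
  have hk := h k le_rfl
  have hdivk := (regDivAt_iff_unit (hη k) _).1 hk.2
  intro j hj
  rcases Nat.lt_or_ge j (k + 1) with hjk | hjk
  · -- old scales: monotonicity in the constant; the divergence clause re-read at the new spacing
    have hj' : j ≤ k := Nat.lt_succ_iff.mp hjk
    obtain ⟨hp, hd⟩ := h j hj'
    refine ⟨hp.mono_eps hmono, (regDivAt_iff_unit (hη (k + 1)) _).2 fun b hb => ?_⟩
    have := (regDivAt_iff_unit (hη k) _).1 hd b hb
    exact this.trans_le (mul_le_mul_of_nonneg_right hmono (by positivity))
  · -- the new top scale `j = k + 1` from the old top scale `j = k`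
    obtain rfl : j = k + 1 := le_antisymm hj hjk
    exact ⟨fun q hq => (hk.1 q hq).trans_le (arith2 _ hL1),
      (regDivAt_iff_unit (hη (k + 1)) _).2 fun b hb => (hdivk b hb).trans_le (le_of_eq (arith3 _ hL1))⟩

/-- **(13) in the carrier's field**: `U ∈ 𝔘_k(e)` of the level-`k` member gives `U ∈ 𝔘_{k+1}(L³e)` of the level-`(k+1)` member (`C₁ = L³`; `e ≥ 0`).
[cite: Balaban1985Variational, (13) p.280] -/
theorem inU_levelSucc {K k : ℕ} (R₀ R₁ : RegCarrierT F N K) {e : ℝ} (he : 0 ≤ e) {U : GaugeField (F.P K) 0 (SU N)}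
    (h : (varProblemT F N K k R₀).InU e U) : (varProblemT F N K (k + 1) R₁).InU ((F.L : ℝ) ^ 3 * e) U := by
  have := inUkClassB11_levelSucc (F := F) (N := N) he h
  rwa [T4Family.P_L] at this

/-- **(3) ONE LEVEL UP, EXACT**: `U ∈ 𝔅_k(V₀)` for `V₀ = faceSec V` gives `U ∈ 𝔅_{k+1}(V)` — print's «V̄₀ = V on Λ_k» in use; on the torus of record this is an
identity, not the repaired approximation «|Ū₀ − V| < C′₁ε₁». [cite: Balaban1985Variational, (11) p.279, (13) p.280] -/
theorem inB_succ_of_inB_faceSec {K k : ℕ} (hk : k + 1 ≤ K) (R₀ R₁ : RegCarrierT F N K) {V : GaugeField (F.P K) (k + 1) (SU N)}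
    {U : GaugeField (F.P K) 0 (SU N)} (h : (varProblemT F N K k R₀).InB (faceSec V) U) : (varProblemT F N K (k + 1) R₁).InB V U :=
  iter_succ_of_iter_eq_faceSec hk h

/-- **STEP (12) ⇒ (13) AT OBJECTS** (the sentence of the leaf `B11Thm1.StepA13` for the no-holes carrier, `lift = id`; it implies `B11Thm1TwoTier.StepA13T` at
`κ₀ = 1` for any `C′₁ > 0` under the exact-`Near` reading): a configuration of the level-`k` problem in `𝔘_k(e) ∩ 𝔅_k(V₀)`, `V₀ = faceSec V`, lies in
`𝔘_{k+1}(L³e) ∩ 𝔅_{k+1}(V)`. [cite: Balaban1985Variational, (12)–(13) p.280] -/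
theorem stepA13_objects {K k : ℕ} (hk : k + 1 ≤ K) (R₀ R₁ : RegCarrierT F N K) {e : ℝ} (he : 0 ≤ e) {V : GaugeField (F.P K) (k + 1) (SU N)}
    {U : GaugeField (F.P K) 0 (SU N)} (hU : (varProblemT F N K k R₀).InU e U) (hB : (varProblemT F N K k R₀).InB (faceSec V) U) :
    (varProblemT F N K (k + 1) R₁).InU ((F.L : ℝ) ^ 3 * e) U ∧ (varProblemT F N K (k + 1) R₁).InB V U :=
  ⟨inU_levelSucc R₀ R₁ he hU, inB_succ_of_inB_faceSec hk R₀ R₁ hB⟩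

/-- **«FOR k = 1 … WE TAKE SIMPLY U₀ = V₀» WITH (13)∕(14) AT OBJECTS** (`C₁ = L³`, `B₃ ≥ 7`; the sentence of `B11Thm1.BaseK1`, GAPS G-B11-A2, a THEOREM on the
torus of record): for a level-`1` datum `V` with (7) at `ε₁ > 0`, `V₀ = faceSec V` lies in `𝔘_1(L³B₃ε₁)` and `V̄₀ = V` — n07-a's scale-0 bound
`inUkClassB11_zero_of_plaqSmall` (`V₀ ∈ 𝔘_0(7ε₁)`, `7 = 2(d−1) + 1`) pushed one level up by (13). [cite: Balaban1985Variational, p.280 (the `k = 1` sentence), (14) p.280] -/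
theorem sat14_faceSec_levelOne {K : ℕ} (hK : 1 ≤ K) {B₃ ε₁ : ℝ} (hB₃ : 7 ≤ B₃) (hε₁ : 0 < ε₁) {V : GaugeField (F.P K) 1 (SU N)}
    (hV : PlaqSmall ε₁ V) :
    InUkClassB11 F N K 1 ((F.L : ℝ) ^ 3 * B₃ * ε₁) (faceSec V) ∧ Averaging.iter (avOfRecord F N K) 1 (faceSec V) = V := by
  have h0 : InUkClassB11 F N K 0 (B₃ * ε₁) (faceSec V) :=
    B11Thm1CarrierTLevelZero.inUkClassB11_mono (mul_le_mul_of_nonneg_right hB₃ hε₁.le)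
      (B11Thm1LevelZero.inUkClassB11_zero_of_plaqSmall F N K hε₁ (plaqSmall_faceSec_record hK hε₁ hV))
  refine ⟨?_, iter_succ_of_iter_eq_faceSec hK rfl⟩
  have := inUkClassB11_levelSucc (F := F) (N := N) (by positivity : (0 : ℝ) ≤ B₃ * ε₁) h0
  rwa [T4Family.P_L, ← mul_assoc] at this

/-! ## §3 The inductive background of Sect. A: Theorem 1 one level down ⇒ (12)–(14) -/

/-- **THE INDUCTIVE BACKGROUND (12)–(13) AT NODE 00's OBJECTS**: Theorem 1 at given constants `C` for the level-`k` member (print's inductive assumption) and a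
level-`(k+1)` datum `V` with (7), `0 < ε₁ ≤ a₁`, give `U₀ = U_k(V₀)` — a minimal configuration of the level-`k` problem over `V₀ = faceSec V` in
`𝔘_k(B₃ε₁)` ((12); the clause (8) applied to `V₀`, which satisfies (7) by `reg7_faceSec`) — lying in `𝔘_{k+1}(L³B₃ε₁) ∩ 𝔅_{k+1}(V)` ((13), by `stepA13_objects`).
[cite: Balaban1985Variational, (12)–(13) p.280] -/
theorem exists_background13_of_thm1At {K k : ℕ} (hk : k + 1 ≤ K) (R₀ : RegCarrierT F N K) {C : B11Thm1.Consts}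
    (hT : Thm1At C (varProblemT F N K k R₀)) {ε₁ : ℝ} (hε₁ : 0 < ε₁) (hε₁a : ε₁ ≤ C.a₁) {V : GaugeField (F.P K) (k + 1) (SU N)}
    (hV : PlaqSmall ε₁ V) :
    ∃ U₀ : GaugeField (F.P K) 0 (SU N),
      IsBackground (avOfRecord F N K) {U | InUkClassB11 F N K k (C.B₃ * ε₁) U} k (faceSec V) U₀ ∧
        InUkClassB11 F N K (k + 1) ((F.L : ℝ) ^ 3 * C.B₃ * ε₁) U₀ ∧ Averaging.iter (avOfRecord F N K) (k + 1) U₀ = V := by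
  obtain ⟨U₀, hU, hB, hmin⟩ := (hT ε₁ hε₁ hε₁a (faceSec V) (reg7_faceSec hk R₀ R₀ hε₁ hV)).1
  obtain ⟨hU', hB'⟩ := stepA13_objects hk R₀ R₀ (by have := C.B₃_pos; positivity) hU hB
  exact ⟨U₀, hmin, by rwa [← mul_assoc] at hU', hB'⟩

/-- **(14) WITH `C₁ = L³` FROM THEOREM 1 ONE LEVEL DOWN**, in the carrier's fields: `U₀ ∈ 𝔘_{k+1}(C₁B₃ε₁) ∩ 𝔅_{k+1}(V)` — the exact boundary condition of (13),
which gives (14)'s «|Ū₀ − V| < C₁ε₁» in every reading of that clause (`B11Thm1.VarProblemA.LawsA` (v)). [cite: Balaban1985Variational, (14) p.280] -/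
theorem sat14_of_thm1At {K k : ℕ} (hk : k + 1 ≤ K) (R₀ R₁ : RegCarrierT F N K) {C : B11Thm1.Consts}
    (hT : Thm1At C (varProblemT F N K k R₀)) {ε₁ : ℝ} (hε₁ : 0 < ε₁) (hε₁a : ε₁ ≤ C.a₁) {V : GaugeField (F.P K) (k + 1) (SU N)}
    (hV : (varProblemT F N K (k + 1) R₁).Reg7 ε₁ V) :
    ∃ U₀ : GaugeField (F.P K) 0 (SU N),
      (varProblemT F N K (k + 1) R₁).InU ((F.L : ℝ) ^ 3 * C.B₃ * ε₁) U₀ ∧ (varProblemT F N K (k + 1) R₁).InB V U₀ := by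
  obtain ⟨U₀, -, hU, hB⟩ := exists_background13_of_thm1At hk R₀ hT hε₁ hε₁a hV
  exact ⟨U₀, hU, hB⟩

/-- **BACKGROUNDS AT EVERY LEVEL `k ≤ k₀ + 1` FROM THEOREM 1 AT THE LEVELS `≤ k₀`** (one block of constants `C` with `7 ≤ L³B₃`; at level `0` the background is
`V` itself — `Ū^0 = U`, n07-a's scale-0 bound): for every `k ≤ k₀ + 1`, `k ≤ K`, `0 < ε₁ ≤ a₁` and every level-`k` datum `V` with (7), some `U₀ ∈ 𝔘_k(L³B₃ε₁)` has
`Ū₀^k = V` — the supply `hbg` of `B11Thm1.prop7Printed_of_from14` at NODE 00's objects, i.e. what turns Proposition 7 proved from a background into the printed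
background-free Proposition 7 along the induction. [cite: Balaban1985Variational, (14) p.280, Prop. 7 p.299] -/
theorem exists_background14_upTo_of_thm1At {K k₀ : ℕ} (R : ℕ → RegCarrierT F N K) {C : B11Thm1.Consts}
    (hT : ∀ k, k ≤ k₀ → k + 1 ≤ K → Thm1At C (varProblemT F N K k (R k))) (hB₃ : 7 ≤ (F.L : ℝ) ^ 3 * C.B₃)
    {k : ℕ} (hk₀ : k ≤ k₀ + 1) (hkK : k ≤ K) {ε₁ : ℝ} (hε₁ : 0 < ε₁) (hε₁a : ε₁ ≤ C.a₁) {V : GaugeField (F.P K) k (SU N)} (hV : PlaqSmall ε₁ V) :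
    ∃ U₀ : GaugeField (F.P K) 0 (SU N), InUkClassB11 F N K k ((F.L : ℝ) ^ 3 * C.B₃ * ε₁) U₀ ∧ Averaging.iter (avOfRecord F N K) k U₀ = V := by
  cases k with
  | zero =>
      refine ⟨V, B11Thm1CarrierTLevelZero.inUkClassB11_mono ?_ (B11Thm1LevelZero.inUkClassB11_zero_of_plaqSmall F N K hε₁ hV), rfl⟩
      have := mul_le_mul_of_nonneg_right hB₃ hε₁.le
      linarith [this]
  | succ k =>
      obtain ⟨U₀, -, hU, hB⟩ :=
        exists_background13_of_thm1At hkK (R k) (hT k (Nat.succ_le_succ_iff.mp hk₀) hkK) hε₁ hε₁a hV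
      exact ⟨U₀, hU, hB⟩

/-! ## §4 Keyed to the bundle of record `Z11OfRecord F N ζ` (members `⟨K, k+1, _⟩ ↦ ⟨K, k, _⟩` of print's family index `ZIdx`) -/

/-- **SECT. A FOR THE THEOREM-1 FAMILY OF RECORD** (`Node00.famVOfRecord F N ζ ⟨K, k, _⟩ = varProblemT F N K k (ζ.R _)`, CarriersZ :90, `rfl`), at the pair of
members «level `k + 1`» ∕ «level `k`» on the same torus `F.P K` — in the carrier's OWN fields: (11) the datum `V₀ = faceSec V` keeps (7) with the same `ε₁`;
(12) ⇒ (13) a configuration in `𝔘_k(e) ∩ 𝔅_k(V₀)` lies in `𝔘_{k+1}(L³e) ∩ 𝔅_{k+1}(V)`.  What seat -d's `TowerT` at `famXOfRecord` reads as `StepA11T ∕ StepA13T`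
(κ₀ = 1, exact `Near`). [cite: Balaban1985Variational, (11)–(13) pp.279–280] -/
theorem sectA_famVOfRecord (ζ : ResidZ F N) {K k : ℕ} (hk : k + 1 ≤ K) :
    (∀ ε₁ : ℝ, 0 < ε₁ → ∀ V : GaugeField (F.P K) (k + 1) (SU N),
        (famVOfRecord F N ζ ⟨K, k + 1, hk⟩).Reg7 ε₁ V → (famVOfRecord F N ζ ⟨K, k, (Nat.le_succ k).trans hk⟩).Reg7 ε₁ (faceSec V)) ∧
      (∀ e : ℝ, 0 ≤ e → ∀ (V : GaugeField (F.P K) (k + 1) (SU N)) (U : GaugeField (F.P K) 0 (SU N)),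
        (famVOfRecord F N ζ ⟨K, k, (Nat.le_succ k).trans hk⟩).InU e U →
          (famVOfRecord F N ζ ⟨K, k, (Nat.le_succ k).trans hk⟩).InB (faceSec V) U →
            (famVOfRecord F N ζ ⟨K, k + 1, hk⟩).InU ((F.L : ℝ) ^ 3 * e) U ∧ (famVOfRecord F N ζ ⟨K, k + 1, hk⟩).InB V U) :=
  ⟨fun _ hε₁ _ hV => reg7_faceSec hk _ _ hε₁ hV, fun _ he _ _ hU hB => stepA13_objects hk _ _ he hU hB⟩

/-- **THE INDUCTIVE BACKGROUND FOR THE FAMILY OF RECORD**: Theorem 1 at constants `C` for the member `⟨K, k, _⟩` of `famVOfRecord F N ζ` and a level-`(k+1)` datum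
`V` with (7), `0 < ε₁ ≤ a₁`, give a configuration of the member `⟨K, k+1, _⟩` in `𝔘_{k+1}(L³B₃ε₁) ∩ 𝔅_{k+1}(V)` ((12)–(14) with `C₁ = L³`).
[cite: Balaban1985Variational, (12)–(14) p.280] -/
theorem exists_sat14_famVOfRecord_of_thm1At (ζ : ResidZ F N) {K k : ℕ} (hk : k + 1 ≤ K) {C : B11Thm1.Consts}
    (hT : Thm1At C (famVOfRecord F N ζ ⟨K, k, (Nat.le_succ k).trans hk⟩)) {ε₁ : ℝ} (hε₁ : 0 < ε₁) (hε₁a : ε₁ ≤ C.a₁)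
    {V : GaugeField (F.P K) (k + 1) (SU N)} (hV : (famVOfRecord F N ζ ⟨K, k + 1, hk⟩).Reg7 ε₁ V) :
    ∃ U₀ : GaugeField (F.P K) 0 (SU N),
      (famVOfRecord F N ζ ⟨K, k + 1, hk⟩).InU ((F.L : ℝ) ^ 3 * C.B₃ * ε₁) U₀ ∧ (famVOfRecord F N ζ ⟨K, k + 1, hk⟩).InB V U₀ :=
  sat14_of_thm1At hk _ _ hT hε₁ hε₁a hV

end Summit.QuantumFields.YangMills.BalabanUVNodes.N07SectAObjects

end
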